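import Mathlib
import HarnessLib.Audit
import Summits.PneNP.PneNP.Theorems.ClusOshRungs

/-!
# Route ClusUniversalCertificate — splitting the colex-standard monomials along the largest variable (osh-P2.md F1(b), the two transfer claims)
(rung F-N1, cell pnp-ideate, crux `UniversalCertAll` = stmt-PneNP-19683; planner p1 g14, `HOME/pnp-ideate-p1/lines/osh-P2.md` §2 F1(b):
`osh(Y) = osh(U) ⊔ {T ∪ {k} : T ∈ osh(I)}` along the largest variable `x_k`, `U` the projection, `I` the double fibres; restricted-model combinatorics —
nothing here bears on `P` versus `NP`)

For `Y ⊆ 𝔽₂^{N+1}` with last coordinate `x_N` the LARGEST variable of the colex order: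

* `emb S = S ↪ Fin (N+1)` (cast), `cut T` (its inverse on sets avoiding `last`); `chi_emb`, `chi_insert_emb`; colex bookkeeping (`emb_lt_emb`, `lt_of_last`,
  `lt_insert_emb_iff`);
* `pullU` — pull a function on `U` back to `Y`; `diffI` — the difference of the two fibres over `I`;
* `colexStd_emb` — **`x_S` (with `N ∉ S`) is standard for `Y` iff it is standard for `U`**;
* `colexStd_insert` — **`x_S x_N` is standard for `Y` iff `x_S` is standard for `I`**.

The recursion `S(Y) = S(U) + S(I) + |I|` (`ClusOshRungs.OshSucc`) follows by re-indexing (`ClusOshSucc`).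
-/

set_option linter.dupNamespace false -- `Summit.PneNP.PneNP.…`: summit = sub-problem name (D-0017 single-conjunct layout)

namespace Summit.PneNP.PneNP.Theorems.ClusHilbert.Osh

open Finset
open Summit.PneNP.PneNP.Theorems.ClusCube (V)
open Summit.PneNP.PneNP.Theorems.ClusHilbert (chi resTo)

variable {N : ℕ}

/-! ## Sets with and without the last coordinate -/

/-- embed a set of the first `N` coordinates -/
def emb (S : Finset (Fin N)) : Finset (Fin (N + 1)) := S.image Fin.castSucc

/-- cut a set of coordinates down to the first `N` -/
def cut (T : Finset (Fin (N + 1))) : Finset (Fin N) := univ.filter fun i => Fin.castSucc i ∈ T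

/-- `last ∉ emb S`. -/
theorem last_notMem_emb (S : Finset (Fin N)) : Fin.last N ∉ emb S := by
  unfold emb
  rw [mem_image]
  rintro ⟨i, -, h⟩
  exact (Fin.castSucc_lt_last i).ne h

/-- `cut (emb S) = S`. -/
theorem cut_emb (S : Finset (Fin N)) : cut (emb S) = S := by
  ext i
  unfold cut emb
  simp only [mem_filter, mem_univ, true_and, mem_image]
  constructor
  · rintro ⟨j, hj, h⟩; rwa [← Fin.castSucc_injective N h]
  · intro h; exact ⟨i, h, rfl⟩

/-- `emb (cut T) = T` when `last ∉ T`. -/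
theorem emb_cut {T : Finset (Fin (N + 1))} (hT : Fin.last N ∉ T) : emb (cut T) = T := by
  ext a
  unfold cut emb
  simp only [mem_image, mem_filter, mem_univ, true_and]
  constructor
  · rintro ⟨i, hi, rfl⟩; exact hi
  · intro ha
    induction a using Fin.lastCases with
    | last => exact absurd ha hT
    | cast i => exact ⟨i, ha, rfl⟩

/-- `#(emb S) = #S`. -/
theorem card_emb (S : Finset (Fin N)) : (emb S).card = S.card := by
  unfold emb; exact card_image_of_injective _ (Fin.castSucc_injective N)

/-- `emb` is injective. -/
theorem emb_injective : Function.Injective (emb (N := N)) := fun S S' h => by rw [← cut_emb S, h, cut_emb]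

/-- `χ_{emb S}(y) = χ_S(init y)`. -/
theorem chi_emb (S : Finset (Fin N)) (y : V (N + 1)) : chi (emb S) y = chi S (Fin.init y) := by
  unfold ClusHilbert.chi emb
  rw [prod_image fun i _ j _ h => Fin.castSucc_injective N h]
  rfl

/-- `χ_{emb S ∪ {N}}(y) = y_N · χ_S(init y)`. -/
theorem chi_insert_emb (S : Finset (Fin N)) (y : V (N + 1)) : chi (insert (Fin.last N) (emb S)) y = y (Fin.last N) * chi S (Fin.init y) := by
  unfold ClusHilbert.chi
  rw [prod_insert (last_notMem_emb S)]
  congr 1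
  exact chi_emb S y

/-! ## Colex bookkeeping -/

/-- `emb` preserves the colex order. -/
theorem emb_lt_emb {S S' : Finset (Fin N)} : toColex (emb S') < toColex (emb S) ↔ toColex S' < toColex S := by
  unfold emb; exact Colex.toColex_image_lt_toColex_image Fin.strictMono_castSucc

/-- A set avoiding `last` is colex-below every set containing it. -/
theorem lt_of_last {T T' : Finset (Fin (N + 1))} (hT' : Fin.last N ∉ T') (hT : Fin.last N ∈ T) : toColex T' < toColex T := by
  rw [Colex.toColex_lt_toColex_iff_exists_forall_lt]
  refine ⟨Fin.last N, hT, hT', fun b hb _ => ?_⟩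
  exact lt_of_le_of_ne (Fin.le_last b) fun h => hT' (h ▸ hb)

/-- Below `emb S`: exactly the `emb S'` with `S' < S`. -/
theorem lt_emb_iff {S : Finset (Fin N)} {T' : Finset (Fin (N + 1))} : toColex T' < toColex (emb S) ↔ Fin.last N ∉ T' ∧ toColex (cut T') < toColex S := by
  constructor
  · intro h
    have hl : Fin.last N ∉ T' := fun hl => (lt_of_last (last_notMem_emb S) hl).not_gt h
    refine ⟨hl, ?_⟩
    rw [← emb_lt_emb, emb_cut hl]; exact h
  · rintro ⟨hl, h⟩
    rw [← emb_lt_emb, emb_cut hl] at h; exact h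

/-- Below `emb S ∪ {N}`: the sets avoiding `last`, and the `emb S' ∪ {N}` with `S' < S`. -/
theorem lt_insert_emb_iff {S : Finset (Fin N)} {T' : Finset (Fin (N + 1))} :
    toColex T' < toColex (insert (Fin.last N) (emb S)) ↔ Fin.last N ∉ T' ∨ (Fin.last N ∈ T' ∧ toColex (cut (T'.erase (Fin.last N))) < toColex S) := by
  by_cases hl : Fin.last N ∈ T'
  · have key : toColex T' < toColex (insert (Fin.last N) (emb S)) ↔ toColex (cut (T'.erase (Fin.last N))) < toColex S := by
      have h1 := Colex.toColex_sdiff_lt_toColex_sdiff (singleton_subset_iff.2 hl) (singleton_subset_iff.2 (mem_insert_self (Fin.last N) (emb S)))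
      rw [← h1, sdiff_singleton_eq_erase, sdiff_singleton_eq_erase, erase_insert (last_notMem_emb S)]
      conv_rhs => rw [← emb_lt_emb (N := N), emb_cut (show Fin.last N ∉ T'.erase (Fin.last N) from fun h => (mem_erase.1 h).1 rfl)]
    rw [key]
    constructor
    · intro h; exact Or.inr ⟨hl, h⟩
    · rintro (h | ⟨-, h⟩)
      · exact absurd hl h
      · exact h
  · constructor
    · intro _; exact Or.inl hl
    · intro _; exact lt_of_last hl (mem_insert_self _ _)

/-! ## Levels, projection, double fibres -/

/-- Membership in a level. -/
theorem mem_lvl {Y : Finset (V (N + 1))} {b : ZMod 2} {w : V N} : w ∈ lvl Y b ↔ Fin.snoc w b ∈ Y := by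
  unfold lvl
  rw [mem_image]
  constructor
  · rintro ⟨y, hy, rfl⟩
    rw [mem_filter] at hy
    have : Fin.snoc (Fin.init y) (y (Fin.last N)) = y := Fin.snoc_init_self y
    rw [hy.2] at this
    rw [this]; exact hy.1
  · intro h
    exact ⟨Fin.snoc w b, mem_filter.2 ⟨h, by simp⟩, Fin.init_snoc _ _⟩

/-- The projection of a point of `Y`. -/
theorem init_mem_proj {Y : Finset (V (N + 1))} {y : V (N + 1)} (hy : y ∈ Y) : Fin.init y ∈ proj Y := by
  unfold proj
  rw [mem_union, mem_lvl, mem_lvl]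
  rcases (by decide : ∀ z : ZMod 2, z = 0 ∨ z = 1) (y (Fin.last N)) with h | h
  · left; rw [← h, Fin.snoc_init_self]; exact hy
  · right; rw [← h, Fin.snoc_init_self]; exact hy

/-- Points of the projection lift. -/
theorem exists_of_mem_proj {Y : Finset (V (N + 1))} {w : V N} (hw : w ∈ proj Y) : ∃ y ∈ Y, Fin.init y = w := by
  unfold proj at hw
  rcases mem_union.1 hw with h | h
  · exact ⟨_, mem_lvl.1 h, Fin.init_snoc _ _⟩
  · exact ⟨_, mem_lvl.1 h, Fin.init_snoc _ _⟩

/-- Double fibres have both lifts. -/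
theorem mem_dbl {Y : Finset (V (N + 1))} {w : V N} : w ∈ dbl Y ↔ Fin.snoc w 0 ∈ Y ∧ Fin.snoc w 1 ∈ Y := by
  unfold dbl
  rw [mem_inter, mem_lvl, mem_lvl]

/-! ## Pulling back from `U`, differencing over `I` -/

/-- pull a function on `U = proj Y` back to `Y` -/
def pullU (Y : Finset (V (N + 1))) : (proj Y → ZMod 2) →ₗ[ZMod 2] (Y → ZMod 2) where
  toFun f := fun y => f ⟨Fin.init y.1, init_mem_proj y.2⟩
  map_add' _ _ := rfl
  map_smul' _ _ := rfl

/-- `pullU` is injective. -/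
theorem pullU_injective (Y : Finset (V (N + 1))) : Function.Injective (pullU Y) := by
  intro f g h
  funext w
  obtain ⟨y, hy, hyw⟩ := exists_of_mem_proj w.2
  have := congrFun h ⟨y, hy⟩
  have hw : (⟨Fin.init y, init_mem_proj hy⟩ : proj Y) = w := Subtype.ext hyw
  simpa [pullU, hw] using this

/-- `χ_{emb S}` on `Y` is the pull-back of `χ_S` on `U`. -/
theorem resTo_chi_emb (Y : Finset (V (N + 1))) (S : Finset (Fin N)) : resTo Y (chi (emb S)) = pullU Y (resTo (proj Y) (chi S)) := by
  funext y
  exact chi_emb S y.1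

/-- the difference of the two fibres over the double points -/
def diffI (Y : Finset (V (N + 1))) : (Y → ZMod 2) →ₗ[ZMod 2] (dbl Y → ZMod 2) where
  toFun F := fun w => F ⟨Fin.snoc w.1 1, (mem_dbl.1 w.2).2⟩ + F ⟨Fin.snoc w.1 0, (mem_dbl.1 w.2).1⟩
  map_add' F G := by funext w; simp only [Pi.add_apply]; ring
  map_smul' c F := by funext w; simp only [Pi.smul_apply, smul_eq_mul, RingHom.id_apply]; ring

/-- `diffI` kills pull-backs. -/
theorem diffI_resTo_chi_emb (Y : Finset (V (N + 1))) (S : Finset (Fin N)) : diffI Y (resTo Y (chi (emb S))) = 0 := by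
  funext w
  show chi (emb S) (Fin.snoc w.1 1) + chi (emb S) (Fin.snoc w.1 0) = 0
  rw [chi_emb, chi_emb, Fin.init_snoc, Fin.init_snoc]
  exact CharTwo.add_self_eq_zero _

/-- `diffI` of `χ_{emb S ∪ {N}}` is `χ_S` on `I`. -/
theorem diffI_resTo_chi_insert (Y : Finset (V (N + 1))) (S : Finset (Fin N)) :
    diffI Y (resTo Y (chi (insert (Fin.last N) (emb S)))) = resTo (dbl Y) (chi S) := by
  funext w
  show chi (insert (Fin.last N) (emb S)) (Fin.snoc w.1 1) + chi (insert (Fin.last N) (emb S)) (Fin.snoc w.1 0) = chi S w.1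
  rw [chi_insert_emb, chi_insert_emb, Fin.init_snoc, Fin.init_snoc, Fin.snoc_last, Fin.snoc_last, one_mul, zero_mul, add_zero]

/-- Every pull-back is a combination of the `χ_{emb S}`. -/
theorem pullU_mem_span (Y : Finset (V (N + 1))) (f : proj Y → ZMod 2) :
    pullU Y f ∈ Submodule.span (ZMod 2) (Set.range fun S : Finset (Fin N) => resTo Y (chi (emb S))) := by
  have hf : f ∈ Submodule.span (ZMod 2) (Set.range fun S : Finset (Fin N) => resTo (proj Y) (chi S)) := by
    have htop := span_colexStd_eq_top (proj Y)
    have hle : Submodule.span (ZMod 2) (Set.range fun T : {T : Finset (Fin N) // colexStd (proj Y) T} => resTo (proj Y) (chi T.1)) ≤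
        Submodule.span (ZMod 2) (Set.range fun S : Finset (Fin N) => resTo (proj Y) (chi S)) :=
      Submodule.span_mono (by rintro _ ⟨T, rfl⟩; exact ⟨T.1, rfl⟩)
    exact hle (htop ▸ Submodule.mem_top)
  have hr : (fun S : Finset (Fin N) => resTo Y (chi (emb S))) = (pullU Y) ∘ (fun S => resTo (proj Y) (chi S)) := by
    funext S; exact resTo_chi_emb Y S
  rw [hr, Set.range_comp, ← Submodule.map_span]
  exact Submodule.mem_map_of_mem hf

/-! ## The two transfer claims -/

/-- **`x_S` (no `x_N`) is colex-standard for `Y` iff it is for the projection `U`.** -/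
theorem colexStd_emb (Y : Finset (V (N + 1))) (S : Finset (Fin N)) : colexStd Y (emb S) ↔ colexStd (proj Y) S := by
  unfold colexStd
  -- the generating sets correspond under `pullU`
  have hset : ((fun T' => resTo Y (chi T')) '' {T' : Finset (Fin (N + 1)) | toColex T' < toColex (emb S)}) =
      (pullU Y) '' ((fun S' => resTo (proj Y) (chi S')) '' {S' : Finset (Fin N) | toColex S' < toColex S}) := by
    ext F
    simp only [Set.mem_image, Set.mem_setOf_eq]
    constructor
    · rintro ⟨T', hT', rfl⟩
      obtain ⟨hl, hlt⟩ := lt_emb_iff.1 hT'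
      refine ⟨_, ⟨cut T', hlt, rfl⟩, ?_⟩
      rw [← resTo_chi_emb, emb_cut hl]
    · rintro ⟨_, ⟨S', hS', rfl⟩, rfl⟩
      refine ⟨emb S', lt_emb_iff.2 ⟨last_notMem_emb S', by rw [cut_emb]; exact hS'⟩, ?_⟩
      rw [resTo_chi_emb]
  rw [hset, ← Submodule.map_span, resTo_chi_emb, not_iff_not]
  constructor
  · intro h
    obtain ⟨g, hg, hgf⟩ := Submodule.mem_map.1 h
    rwa [← pullU_injective Y hgf]
  · intro h
    exact Submodule.mem_map_of_mem h

/-- **`x_S · x_N` is colex-standard for `Y` iff `x_S` is for the double fibres `I`.** -/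
theorem colexStd_insert (Y : Finset (V (N + 1))) (S : Finset (Fin N)) :
    colexStd Y (insert (Fin.last N) (emb S)) ↔ colexStd (dbl Y) S := by
  classical
  unfold colexStd
  rw [not_iff_not]
  constructor
  · -- apply `diffI`: sets without `x_N` die, `emb S' ∪ {N}` becomes `χ_{S'}` on `I`
    intro h
    have h' := Submodule.mem_map_of_mem (f := diffI Y) h
    rw [diffI_resTo_chi_insert, Submodule.map_span] at h'
    refine (Submodule.span_le.2 ?_) h'
    rintro _ ⟨_, ⟨T', hT', rfl⟩, rfl⟩
    rcases lt_insert_emb_iff.1 hT' with hl | ⟨hl, hlt⟩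
    · rw [← emb_cut hl, diffI_resTo_chi_emb]
      exact Submodule.zero_mem _
    · have hT'eq : T' = insert (Fin.last N) (emb (cut (T'.erase (Fin.last N)))) := by
        rw [emb_cut (fun h => (mem_erase.1 h).1 rfl), insert_erase hl]
      rw [hT'eq, diffI_resTo_chi_insert]
      exact Submodule.subset_span ⟨_, hlt, rfl⟩
  · -- a relation on `I` lifts: `χ_S x_N = Σ c χ_{S'} x_N + (a function of the first N coordinates)` on `Y`
    intro h
    set G := Submodule.span (ZMod 2) ((fun T' => resTo Y (chi T')) '' {T' : Finset (Fin (N + 1)) | toColex T' < toColex (insert (Fin.last N) (emb S))})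
      with hG
    -- the lifted relation: `F := χ_{S∪N} + Σ c χ_{S'∪N}` is a pull-back
    rw [Finsupp.mem_span_image_iff_linearCombination] at h
    obtain ⟨c, hc, hsum⟩ := h
    -- `g := Σ c χ_{S'}` agrees with `χ_S` on `I`
    let L : Finset (Fin (N + 1)) → (Y → ZMod 2) := fun T' => resTo Y (chi T')
    have hlift : ∀ S' ∈ c.support, resTo Y (chi (insert (Fin.last N) (emb S'))) ∈ G := by
      intro S' hS'
      have hlt : toColex S' < toColex S := hc hS'
      exact Submodule.subset_span ⟨_, lt_insert_emb_iff.2 (Or.inr ⟨mem_insert_self _ _, by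
        rw [erase_insert (last_notMem_emb S'), cut_emb]; exact hlt⟩), rfl⟩
    -- the difference is a function of `init y` only
    let F : Y → ZMod 2 := resTo Y (chi (insert (Fin.last N) (emb S))) + ∑ S' ∈ c.support, c S' • resTo Y (chi (insert (Fin.last N) (emb S')))
    have hFpull : ∃ f : proj Y → ZMod 2, F = pullU Y f := by
      -- value of `F` at `y = (w, b)`: `b · (χ_S(w) + g(w))`, and `χ_S + g` vanishes on `I`
      have hval : ∀ y : Y, F y = y.1 (Fin.last N) * (chi S (Fin.init y.1) + ∑ S' ∈ c.support, c S' * chi S' (Fin.init y.1)) := by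
        intro y
        simp only [F, Pi.add_apply, Finset.sum_apply, Pi.smul_apply, smul_eq_mul]
        show chi (insert (Fin.last N) (emb S)) y.1 + ∑ S' ∈ c.support, c S' * chi (insert (Fin.last N) (emb S')) y.1 = _
        rw [chi_insert_emb, mul_add, mul_sum]
        congr 1
        exact sum_congr rfl fun S' _ => by rw [chi_insert_emb]; ring
      have hI : ∀ w ∈ dbl Y, chi S w + ∑ S' ∈ c.support, c S' * chi S' w = 0 := by
        intro w hw
        have := congrFun hsum ⟨w, hw⟩
        rw [Finsupp.linearCombination_apply, Finsupp.sum] at this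
        simp only [Finset.sum_apply, Pi.smul_apply, smul_eq_mul] at this
        -- `this : Σ c S' * χ_{S'}(w) = χ_S(w)` on `I`
        have e : ∀ a b : ZMod 2, a = b → b + a = 0 := by decide
        exact e _ _ this
      refine ⟨fun w => if hw : Fin.snoc w.1 1 ∈ Y then F ⟨Fin.snoc w.1 1, hw⟩ else 0, ?_⟩
      funext y
      show F y = (if hw : Fin.snoc (Fin.init y.1) 1 ∈ Y then F ⟨Fin.snoc (Fin.init y.1) 1, hw⟩ else 0)
      rcases (by decide : ∀ z : ZMod 2, z = 0 ∨ z = 1) (y.1 (Fin.last N)) with h0 | h1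
      · -- lower fibre: `F y = 0`; the upper value (if present) vanishes because `w ∈ I`
        rw [hval, h0, zero_mul]
        split_ifs with hw
        · rw [hval]
          simp only [Fin.snoc_last, Fin.init_snoc, one_mul]
          refine (hI _ (mem_dbl.2 ⟨?_, hw⟩)).symm
          rw [← h0, Fin.snoc_init_self]; exact y.2
        · rfl
      · have hy : Fin.snoc (Fin.init y.1) 1 = y.1 := by rw [← h1, Fin.snoc_init_self]
        have hw : Fin.snoc (Fin.init y.1) 1 ∈ Y := by rw [hy]; exact y.2
        rw [dif_pos hw]
        congr 1
        exact Subtype.ext hy.symm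
    obtain ⟨f, hf⟩ := hFpull
    have hFG : F ∈ G := by
      rw [hf]
      refine (Submodule.span_le.2 ?_) (pullU_mem_span Y f)
      rintro _ ⟨S'', rfl⟩
      exact Submodule.subset_span ⟨emb S'', lt_of_last (last_notMem_emb S'') (mem_insert_self _ _), rfl⟩
    have hsumG : ∑ S' ∈ c.support, c S' • resTo Y (chi (insert (Fin.last N) (emb S'))) ∈ G :=
      Submodule.sum_mem _ fun S' hS' => Submodule.smul_mem _ _ (hlift S' hS')
    have : resTo Y (chi (insert (Fin.last N) (emb S))) = F - ∑ S' ∈ c.support, c S' • resTo Y (chi (insert (Fin.last N) (emb S'))) := by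
      simp only [F, add_sub_cancel_right]
    rw [this]
    exact Submodule.sub_mem _ hFG hsumG

end Summit.PneNP.PneNP.Theorems.ClusHilbert.Osh
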